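import Literature.MathematicalPhysics.KineticTheory.PalmMismatchRingTheorems
import HarnessLib

/-!
# Palm-mismatch collision operator, III: the flow average cannot see the up/down Palm asymmetry

Topic `Literature/MathematicalPhysics/KineticTheory`; second sequel of `PalmMismatchRing.lean`
(definition request `defn-palmMismatchOperator`, route CollisionNoise). Proved here:

* `exchangeMatrix_mulVec_inr`: `R_x` swaps `p_x ↔ p_{x+1}` and fixes the other momenta (and all
  positions, `exchangeMatrix_mulVec_inl`), i.e. it is the elastic equal-mass collision of the request.
* `trace_mul_crossPattern_eq_zero`: for a flow-invariant covariance `C` and a flow-invariant form `Q`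
  (general generator `A`), the symmetrised pattern `(Cℓ*)(C(ℓA)*)ᵀ + transpose` has zero `Q`-trace.
  With `ℓ = ℓ_r` (so `ℓA = ℓ_ṙ`) this is the difference `M⁺ - M⁻ = 2√(πλ₂/2)(uwᵀ + wuᵀ)` of the up- and
  down-crossing Palm second moments (`trace_mul_palmSecondMoment_sub_eq_zero`): the free turnaround,
  which carries the up-crossing Palm law to the down-crossing one [HevelingLast2005, Thm 1.1], is
  invisible to every flow-invariant quadratic observable — as it must be, such an observable being
  constant along the free excursion. Consequently the request's operator may equivalently be computed
  from `R_x M⁺ R_xᵀ - M⁺` (no turnaround at all) after the flow average.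
-/

noncomputable section

open Matrix Finset

namespace Literature.MathematicalPhysics.KineticTheory.PalmMismatch

variable {n : ℕ} [NeZero n]

section Nontrivial

variable [Fact (1 < n)]

/-- `R_x` swaps `p_x ↔ p_{x+1}` and fixes the other momenta. [folklore] -/
theorem exchangeMatrix_mulVec_inr (x : ZMod n) (v : PhaseIdx n → ℝ) (y : ZMod n) :
    (exchangeMatrix x *ᵥ v) (Sum.inr y) =
      if y = x then v (Sum.inr (x + 1)) else if y = x + 1 then v (Sum.inr x) else v (Sum.inr y) := by
  rw [exchangeMatrix_mulVec, velCovector_dotProduct]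
  have h := succ_ne_self x
  simp only [Pi.sub_apply, Pi.smul_apply, velCovector, Sum.elim_inr, smul_eq_mul, siteGrad,
    Pi.single_apply]
  by_cases hy : y = x
  · subst hy; simp [h.symm]
  · by_cases hy' : y = x + 1
    · subst hy'; simp [h]
    · simp [hy, hy']

end Nontrivial

/-! ### The cross pattern -/


/-- For flow-invariant `C` and flow-invariant form `Q` (both symmetric), the cross pattern
`(Cℓ*) (C(ℓA)*)ᵀ + transpose` is `Q`-null: `tr(Q (u wᵀ + w uᵀ)) = 0`. Hence the up- and down-crossing
Palm second moments `M^±` have the same flow average, and the "free turnaround" is invisible to every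
flow-invariant quadratic observable (as it must: such an observable is constant along the free
excursion). [folklore] -/
theorem trace_mul_crossPattern_eq_zero {ι : Type*} [Fintype ι]
    {A C Q : Matrix ι ι ℝ} (hC : IsFlowInvariant A C) (hQ : IsFlowInvariantForm A Q)
    (hCs : Cᵀ = C) (hQs : Qᵀ = Q) (ℓ : ι → ℝ) (a b : ℝ) :
    trace (Q * (vecMulVec (a • C *ᵥ ℓ) (b • C *ᵥ (ℓ ᵥ* A)) +
      vecMulVec (b • C *ᵥ (ℓ ᵥ* A)) (a • C *ᵥ ℓ))) = 0 := by
  unfold IsFlowInvariant at hC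
  unfold IsFlowInvariantForm at hQ
  have hCA : C * Aᵀ = -(A * C) := eq_neg_of_add_eq_zero_right hC
  have hQA : Aᵀ * Q = -(Q * A) := eq_neg_of_add_eq_zero_right hQ
  -- `X = C Q C` satisfies `X Aᵀ = -A X`, so `Y = A X` is antisymmetric (`X` is symmetric).
  set X : Matrix ι ι ℝ := C * Q * C with hX
  have hXA : X * Aᵀ = -(A * X) := by
    rw [hX]
    calc C * Q * C * Aᵀ = C * Q * (C * Aᵀ) := by simp [Matrix.mul_assoc]
      _ = -(C * (Q * A) * C) := by rw [hCA]; simp [Matrix.mul_assoc]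
      _ = C * (Aᵀ * Q) * C := by rw [hQA]; simp
      _ = (C * Aᵀ) * (Q * C) := by simp [Matrix.mul_assoc]
      _ = -(A * (C * Q * C)) := by rw [hCA]; simp [Matrix.mul_assoc]
  have hXt : Xᵀ = X := by rw [hX, transpose_mul, transpose_mul, hCs, hQs, Matrix.mul_assoc]
  have hYt : (A * X)ᵀ = -(A * X) := by rw [transpose_mul, hXt, hXA]
  have key : ℓ ⬝ᵥ (A * X) *ᵥ ℓ = 0 := dotProduct_mulVec_self_eq_zero_of_transpose_eq_neg hYt ℓ
  rw [Matrix.mul_add, trace_add, trace_mul_vecMulVec, trace_mul_vecMulVec,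
    dotProduct_mulVec_comm_of_symm hQs (a • C *ᵥ ℓ)]
  -- both terms equal `a b · (C (Aᵀℓ)) · Q (C ℓ) = a b · ℓ · (A C Q C) ℓ`
  have h1 : (b • C *ᵥ (ℓ ᵥ* A)) ⬝ᵥ Q *ᵥ (a • C *ᵥ ℓ) = a * b * (ℓ ⬝ᵥ (A * X) *ᵥ ℓ) := by
    rw [← mulVec_transpose, smul_dotProduct, mulVec_smul, dotProduct_smul, smul_eq_mul,
      smul_eq_mul]
    have h2 : (C *ᵥ (Aᵀ *ᵥ ℓ)) ⬝ᵥ Q *ᵥ (C *ᵥ ℓ) = ℓ ⬝ᵥ (A * X) *ᵥ ℓ := by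
      rw [mulVec_mulVec, mulVec_mulVec, ← vecMul_transpose, dotProduct_mulVec, vecMul_vecMul,
        ← dotProduct_mulVec, transpose_mul, transpose_transpose, hCs, hX]
      simp [Matrix.mul_assoc]
    rw [h2]
    ring
  rw [h1, key]
  ring

/-- **The up- and down-crossing Palm second moments have the same flow average**: for a
flow-invariant symmetric `C` on the ring and every flow-invariant symmetric form `Q`,
`tr(Q (M⁺_x(C) - M⁻_x(C))) = 0`. [folklore] -/
theorem trace_mul_palmSecondMoment_sub_eq_zero (ω₂ : ℝ) {C Q : Matrix (PhaseIdx n) (PhaseIdx n) ℝ}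
    (hC : IsFlowInvariant (flowMatrix n ω₂) C) (hQ : IsFlowInvariantForm (flowMatrix n ω₂) Q)
    (hCs : Cᵀ = C) (hQs : Qᵀ = Q) (x : ZMod n) :
    trace (Q * (palmSecondMoment 1 C x - palmSecondMoment (-1) C x)) = 0 := by
  have h := trace_mul_crossPattern_eq_zero hC hQ hCs hQs (stretchCovector x)
    (stretchVar C x)⁻¹ (velVar C x)⁻¹
  rw [stretchCovector_vecMul_flowMatrix] at h
  unfold palmSecondMoment palmBump palmDrift
  rw [show ∀ (X Y Z : Matrix (PhaseIdx n) (PhaseIdx n) ℝ) (a b : ℝ),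
      X + Y + Z + a • (vecMulVec ((stretchVar C x)⁻¹ • C *ᵥ stretchCovector x)
        ((velVar C x)⁻¹ • C *ᵥ velCovector x) +
        vecMulVec ((velVar C x)⁻¹ • C *ᵥ velCovector x) ((stretchVar C x)⁻¹ • C *ᵥ stretchCovector x))
      - (X + Y + Z + b • (vecMulVec ((stretchVar C x)⁻¹ • C *ᵥ stretchCovector x)
        ((velVar C x)⁻¹ • C *ᵥ velCovector x) +
        vecMulVec ((velVar C x)⁻¹ • C *ᵥ velCovector x) ((stretchVar C x)⁻¹ • C *ᵥ stretchCovector x)))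
      = (a - b) • (vecMulVec ((stretchVar C x)⁻¹ • C *ᵥ stretchCovector x)
        ((velVar C x)⁻¹ • C *ᵥ velCovector x) +
        vecMulVec ((velVar C x)⁻¹ • C *ᵥ velCovector x) ((stretchVar C x)⁻¹ • C *ᵥ stretchCovector x))
      from fun X Y Z a b => by rw [sub_smul]; abel]
  rw [Matrix.mul_smul, trace_smul, h, smul_zero]

end Literature.MathematicalPhysics.KineticTheory.PalmMismatch
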